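import Summits.NavierStokesRegularity.NavierStokesRegularity.Theorems.ScaledTopAlignmentSeqNearMaxGlueKit
import HarnessLib
/-!
# Route `ScaledTopAlignment`: the TYPE-I BLOW-UP PORTRAIT forced by the window-door kits — at a Type-I
# singular time, misaligned near-maximum vorticity windows persist at ALL late times
# (support for the deciding crux W3ᵐᵗ = `AprioriMostTimesBulkAlignment`, stmt-NavierStokesRegularity-19551:
# its registered falsifier, read positively; no import of the route file)

Contrapositive, positive reading of the sequence-door kit `false_of_seqNearMaxBulkAligned_typeI`: let
`(u, p)` be a classical solution of the Navier–Stokes system on `ℝ³ × [0, T)` (viscosity `ν > 0`, no force),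
Leray–Hopf from a rapidly decaying datum, blowing up at `T` at the Type-I rate and NOT extending classically
past `T`. Then for EVERY comparability ratio `λ₀ < 1` and window radius `R₀ > 0` there are thresholds
`κ, q, ε, δ > 0` such that for every level `M`, at ALL times `t` of a final interval `[t₀, T)` some point `x`
is simultaneously: above the level (`|ω(t,x)| ≥ M`), rate-near-maximal (`|ω(t,x)| ≥ κ/(T − t)`), relatively
near-maximal (`|ω(t,x)| ≥ q |ω(t,x′)|` for all `x′`), and carries an `ε`-MISALIGNED part of the relative
`λ₀`-top set inside the window `|x − y| ≤ R₀ ℓ`, `ℓ = √(ν/|ω(t,x)|)`, of volume `> δ ℓ³`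
(`persistent_misaligned_nearMax_windows_of_typeI_blowup`). This is the Giga–Miura mechanism (Type I +
direction coherence ⇒ no blow-up) in the window/measure form of this route, sharpened to "eventually always"
by the flexible zoom at caller-chosen times and backward uniqueness. With the route's residual NoTypeII every
first singularity is of this kind. WHAT THIS IS NOT: not NS regularity and not a blow-up construction — a
necessary condition on hypothetical Type-I singularities, kernel-checked. References: Giga–Miura, CMP 303 (2011)
= HUPS #956, Thm 1.1, §2.1 [GigaMiura2011]; KNSS, Acta Math. 203 (2009) §6 [KochNadirashviliSereginSverak2009].
-/

noncomputable section
-- the summit and its single sub-problem share the name (CONVENTIONS §1), as in every Theorems file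
set_option linter.dupNamespace false
open MeasureTheory Set Function Filter Topology Metric
open scoped RealInnerProductSpace ENNReal
namespace Summit.NavierStokesRegularity.NavierStokesRegularity.Theorems
open Literature.Analysis Literature.Analysis.FluidPDE

/-- **Type-I blow-up portrait: persistent misaligned near-maximum windows.** For `ν > 0`, `T > 0`, a
classical solution `(u, p)` on `ℝ³ × [0, T)`, Leray–Hopf from its rapidly decaying datum `u 0`, with the
Type-I rate at `T` and no smooth extension past `T`, and for every `λ₀ < 1`, `R₀ > 0`: there are
`κ, q, ε, δ > 0` such that for every `M > 0` some final interval `[t₀, T)` consists ENTIRELY of times at which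
some point `x` has `|ω(t,x)| ≥ M`, `|ω(t,x)| ≥ κ/(T−t)`, `q|ω(t,x′)| ≤ |ω(t,x)|` for all `x′`, and an
`ε`-misaligned part of `{ |ω(t,·)| ≥ λ₀|ω(t,x)| } ∩ B(x, R₀ℓ)` of volume `> δ ℓ³` (`ℓ = √(ν/|ω(t,x)|)`).
Contrapositive of `false_of_seqNearMaxBulkAligned_typeI` (slab bounds from
`liouvilleKillsTypeI_exists_bound_Icc`). [cite: GigaMiura2011, Thm 1.1 with Rmk 1.4 and §2.1 (HUPS preprint #956 pp. 3–9)] -/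
theorem persistent_misaligned_nearMax_windows_of_typeI_blowup {ν T : ℝ} (hν : 0 < ν) (hT : 0 < T)
    {u : ℝ → EuclideanSpace ℝ (Fin 3) → EuclideanSpace ℝ (Fin 3)} {p : ℝ → EuclideanSpace ℝ (Fin 3) → ℝ}
    (hsol : IsClassicalNSSolutionOn (Ico 0 T) ν 0 u p) (hLH : IsLerayHopfOn T ν 0 (u 0) u)
    (hdec : HasRapidSpatialDecay (u 0)) (hI : IsTypeIBlowup u T) (hext : ¬ HasSmoothExtensionPast ν 0 u T)
    {lam0 R0 : ℝ} (hlam01 : lam0 < 1) (hR0 : 0 < R0) :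
    ∃ κ : ℝ, 0 < κ ∧ ∃ q : ℝ, 0 < q ∧ ∃ ε : ℝ, 0 < ε ∧ ∃ δ : ℝ, 0 < δ ∧ ∀ M : ℝ, 0 < M →
      ∃ t₀ ∈ Set.Ico 0 T, ∀ t ∈ Set.Ico t₀ T, ∃ x : EuclideanSpace ℝ (Fin 3),
        M ≤ ‖curl (u t) x‖ ∧ κ / (T - t) ≤ ‖curl (u t) x‖ ∧
        (∀ x' : EuclideanSpace ℝ (Fin 3), q * ‖curl (u t) x'‖ ≤ ‖curl (u t) x‖) ∧
        ENNReal.ofReal (δ * Real.sqrt (ν / ‖curl (u t) x‖) ^ 3) <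
          volume {y : EuclideanSpace ℝ (Fin 3) | lam0 * ‖curl (u t) x‖ ≤ ‖curl (u t) y‖ ∧
              ‖x - y‖ ≤ R0 * Real.sqrt (ν / ‖curl (u t) x‖) ∧
              ε < Real.sqrt (1 - (inner ℝ (‖curl (u t) x‖⁻¹ • curl (u t) x)
                (‖curl (u t) y‖⁻¹ • curl (u t) y)) ^ 2)} := by
  by_contra hno
  push Not at hno
  -- slab bounds on closed sub-strips
  have hslab : ∀ T' < T, ∃ M : ℝ, ∀ s ∈ Set.Icc 0 T', ∀ x, ‖u s x‖ ≤ M := by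
    intro T' hT'
    by_cases h : 0 < T'
    · exact liouvilleKillsTypeI_exists_bound_Icc hν hsol hLH hdec ⟨h, hT'⟩
    · obtain ⟨M, hM⟩ := liouvilleKillsTypeI_exists_bound_Icc hν hsol hLH hdec (T' := T / 2)
        ⟨by linarith, by linarith⟩
      push Not at h
      exact ⟨M, fun s hs x => hM s ⟨hs.1, by linarith [hs.2]⟩ x⟩
  refine false_of_seqNearMaxBulkAligned_typeI hν hT hsol hLH hdec hslab hI hext hlam01 hR0
    fun κ hκ q hq ε hε δ hδ => ?_
  obtain ⟨M, hM, hrest⟩ := hno κ hκ q hq ε hε δ hδ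
  -- a good time in every final interval `[max 0 (T - 1/(j+1)), T)`
  have ht0 : ∀ j : ℕ, max 0 (T - 1 / ((j : ℝ) + 1)) ∈ Ico 0 T := fun j =>
    ⟨le_max_left _ _, max_lt hT (sub_lt_self T (by positivity))⟩
  choose ts hts hgood using fun j : ℕ => hrest (max 0 (T - 1 / ((j : ℝ) + 1))) (ht0 j)
  refine ⟨M, hM, ts, fun j => ⟨(le_max_left _ _).trans (hts j).1, (hts j).2⟩, ?_,
    fun j x hMx hκx hqx => hgood j x hMx hκx hqx⟩
  -- `ts → T`
  have hlow : Tendsto (fun j : ℕ => T - 1 / ((j : ℝ) + 1)) atTop (𝓝 T) := by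
    have h := (tendsto_one_div_add_atTop_nhds_zero_nat (𝕜 := ℝ)).const_sub T
    rwa [sub_zero] at h
  exact tendsto_of_tendsto_of_tendsto_of_le_of_le hlow tendsto_const_nhds
    (fun j => (le_max_right _ _).trans (hts j).1) (fun j => (hts j).2.le)

end Summit.NavierStokesRegularity.NavierStokesRegularity.Theorems
end
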